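import Mathlib
import Summits.Schanuel.Schanuel.Theorems.RootDecomp1ELevels
import Literature.Barriers.Schanuel.NesterenkoModularScope
import Literature.NumberTheory.Transcendental.PeriodsWave0Proofs

-- `Summit.Schanuel.Schanuel.…` is the mandated layout of this single-problem summit (CONVENTIONS §1).
set_option linter.dupNamespace false

/-!
# RootDecomp1E, round 11 (lens 2 «LEVELS»), part 2: literal members `Q₁, Q₂`, the E-BASED cell at `n = 3`, its instance

Supports `stmt-Schanuel-31410` / `stmt-Schanuel-25020`.  PORT of §4b, §6, §6b of the lens-2 gen-11 node `Levels.lean`;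
imports part 1 (`RootDecomp1ELevels`); same namespace.
* §4b `Q₁ = (π | 1, i, √2)`: certified member of stmt-31410's class at length `4` (first open length of the type-free
  component), 31410's conclusion PROVED hypothesis-free (`defectOne_at_Q₁`); `Q₂ = (π | 1, i, √2, i√2)` at length `5`.
* §6 the `n = 3` dark layer split by level: `LevelOneDefectOneThree` ⟺ the ANCHORED E-BASED CELL
  `AnchoredEBasedDefectOneThree` (`levelOne_iff_anchoredEBased`, Hermite–Lindemann + two exchange arguments) and
  `FirstFailureLayer 3 ⟺ AnchoredEBased ∧ DeepDark` (`firstFailureLayer_three_iff_anchored_deep`, mod tree-proved facts).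
* §6b the certified instance `(1; (1, e, e²))` of the E-based cell (`eTower_hypotheses`, `anchored_at_eTower`). -/

noncomputable section

namespace Summit.Schanuel.Schanuel.Theorems.RootDecomp1ELevels

open Complex IntermediateField
open Summit.Schanuel.Schanuel.Theses.RootDecomp1E (DefectOneSchanuel EStableDefectOne PlainDefectOne)
open Summit.Schanuel.Schanuel.Theorems.RootDecomp1EAnchor (isAlgebraic_of_mem_adjoin
  trdeg_adjoin_le_of_isAlgebraic mem_adjoin_of_mem_span exp_isAlgebraic_of_mem_span isAlgebraic_transfer
  trdeg_adjoin_le_nat trdeg_le_of_mem_span exists_nat_eq_of_le_natCast span_range_le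
  exists_basis_span_inf isAlgebraic_of_trdeg_sandwich isAlgebraic_of_le isAlgebraic_mul isAlgebraic_add)
open Summit.Schanuel.Schanuel.Theorems.RootDecomp1EModuleGrids (subMinimal_three rat_mul_pi_eq_rat)
open Summit.Schanuel.Schanuel.Theorems.RootDecomp1EModuleType (SubMinimalDefect)
open Summit.Schanuel.Schanuel.Theorems.RootDecomp1EEngineType (LWRich PeriodRich EngineRich
  EngineRichDefectOneAt EngineDarkDefectOneAt FirstFailureLayer defectOne_iff_typeSplit defectOne_iff_layers
  trdeg_eq_nat le_trdeg_add_one_of_subMinimal two_le_trdeg_of_subMinimal trdeg_add_two_eq_of_firstFailure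
  linearIndependent_comp_castLE two_le_trdeg_of_lwRich)
open Literature.NumberTheory.Transcendental (nesterenko nesterenko' algebraicIndependent_exp_holds
  transcendental_pi_holds transcendental_exp_holds transcendental_rat_cexp_one)
open Literature.Barriers.Schanuel (isAlgebraic_I)

-- part-local copy (GATE-DEDUP: part 1's `transcendental_pi_complex` is `private`; twin of a landed statement)
/-- `π ∈ ℂ` is transcendental (tree fact `transcendental_pi_holds`, transported along `ℝ → ℂ`); private part-local copy. -/
private theorem transcendental_pi_complex : Transcendental ℚ (Real.pi : ℂ) := fun hc =>
  transcendental_pi_holds ((isAlgebraic_algebraMap_iff (algebraMap ℝ ℂ).injective).mp hc)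

/-! ### §4b Literal members at lengths 4 and 5: `Q₁ = (π | 1, i, √2)`, `Q₂ = (π | 1, i, √2, i√2)` -/
/-- (private: print-twin of `RootDecomp1HGauge.rat_sqrt_two`, gate dedup) `a + b√2 = 0` with `a, b ∈ ℚ` forces `a = b = 0`. -/
private theorem rat_add_rat_mul_sqrt_two {a c : ℚ} (h : (a : ℝ) + c * Real.sqrt 2 = 0) : a = 0 ∧ c = 0 := by
  by_cases hc : c = 0
  · subst hc
    simp only [Rat.cast_zero, zero_mul, add_zero, Rat.cast_eq_zero] at h
    exact ⟨h, rfl⟩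
  · exfalso
    have hs : Real.sqrt 2 = ((-a / c : ℚ) : ℝ) := by
      push_cast
      field_simp
      linear_combination h
    exact irrational_sqrt_two ⟨-a / c, hs.symm⟩

/-- `√2 ∈ ℂ` is algebraic (= `Literature.Barriers.Schanuel.isAlgebraic_sqrt_two`, whose module
`AxSchanuelFunctionalNotNumerical` has no farm olean (rc 75 unbuilt, 2026-08-30) — restated, GATE-DEDUP `private`). -/
private theorem isAlgebraic_sqrt_two : IsAlgebraic ℚ ((Real.sqrt 2 : ℝ) : ℂ) := by
  have h2 : ((Real.sqrt 2 : ℝ) : ℂ) ^ 2 = ((2 : ℕ) : ℂ) := by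
    rw [← Complex.ofReal_pow, Real.sq_sqrt (by norm_num : (0 : ℝ) ≤ 2)]
    push_cast
    rfl
  exact IsAlgebraic.of_pow (by norm_num : 0 < 2) (h2 ▸ isAlgebraic_nat 2)

/-- `(1, i, √2)` is ℚ-free. -/
theorem linearIndependent_one_I_sqrtTwo : LinearIndependent ℚ ![(1 : ℂ), I, ((Real.sqrt 2 : ℝ) : ℂ)] := by
  rw [Fintype.linearIndependent_iff]
  intro g hg
  simp only [Fin.sum_univ_three, Matrix.cons_val_zero, Matrix.cons_val_one, Matrix.cons_val_two,
    Matrix.tail_cons, Matrix.head_cons, Rat.smul_def] at hg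
  have hre := congrArg Complex.re hg
  have him := congrArg Complex.im hg
  simp only [Complex.add_re, Complex.add_im, Complex.mul_re, Complex.mul_im, Complex.ofReal_re,
    Complex.ofReal_im, Complex.I_re, Complex.I_im, Complex.ratCast_re, Complex.ratCast_im,
    Complex.zero_re, Complex.zero_im, mul_zero, zero_mul, add_zero, zero_add,
    mul_one, sub_self, sub_zero] at hre him
  obtain ⟨h0, h2⟩ := rat_add_rat_mul_sqrt_two (a := g 0) (c := g 2) (by linear_combination hre)
  intro i
  fin_cases i
  · exact h0
  · exact_mod_cast him
  · exact h2

/-- `(1, i, √2, i√2)` is ℚ-free. -/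
theorem linearIndependent_one_I_sqrtTwo_IsqrtTwo :
    LinearIndependent ℚ ![(1 : ℂ), I, ((Real.sqrt 2 : ℝ) : ℂ), I * ((Real.sqrt 2 : ℝ) : ℂ)] := by
  rw [Fintype.linearIndependent_iff]
  intro g hg
  simp only [Fin.sum_univ_four, Matrix.cons_val_zero, Matrix.cons_val_one, Matrix.cons_val_two,
    Matrix.cons_val_three, Matrix.tail_cons, Matrix.head_cons, Rat.smul_def] at hg
  have hre := congrArg Complex.re hg
  have him := congrArg Complex.im hg
  simp only [Complex.add_re, Complex.add_im, Complex.mul_re, Complex.mul_im, Complex.ofReal_re,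
    Complex.ofReal_im, Complex.I_re, Complex.I_im, Complex.ratCast_re, Complex.ratCast_im,
    Complex.zero_re, Complex.zero_im, mul_zero, zero_mul, add_zero, zero_add,
    mul_one, sub_self, sub_zero] at hre him
  obtain ⟨h0, h2⟩ := rat_add_rat_mul_sqrt_two (a := g 0) (c := g 2) (by linear_combination hre)
  obtain ⟨h1, h3⟩ := rat_add_rat_mul_sqrt_two (a := g 1) (c := g 3) (by linear_combination him)
  intro i
  fin_cases i
  · exact h0
  · exact h1
  · exact h2
  · exact h3

/-- The algebraic triple `(1, i, √2)`. -/
def algTriple : Fin 3 → ℂ := ![(1 : ℂ), I, ((Real.sqrt 2 : ℝ) : ℂ)]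

/-- The algebraic quadruple `(1, i, √2, i√2)` (a ℚ-basis of the quartic field `ℚ(i, √2) = ℚ(ζ₈)`). -/
def algQuadruple : Fin 4 → ℂ := ![(1 : ℂ), I, ((Real.sqrt 2 : ℝ) : ℂ), I * ((Real.sqrt 2 : ℝ) : ℂ)]
/-- `(1, i, √2)` is ℚ-linearly independent. -/
theorem algTriple_linearIndependent : LinearIndependent ℚ algTriple := linearIndependent_one_I_sqrtTwo
/-- Every coordinate of `(1, i, √2)` is algebraic. -/
theorem algTriple_isAlgebraic : ∀ j, IsAlgebraic ℚ (algTriple j) := by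
  intro j
  fin_cases j
  · simpa [algTriple] using isAlgebraic_one
  · simpa [algTriple] using isAlgebraic_I
  · simpa [algTriple] using isAlgebraic_sqrt_two
/-- `(1, i, √2, i√2)` is ℚ-linearly independent. -/
theorem algQuadruple_linearIndependent : LinearIndependent ℚ algQuadruple :=
  linearIndependent_one_I_sqrtTwo_IsqrtTwo
/-- Every coordinate of `(1, i, √2, i√2)` is algebraic. -/
theorem algQuadruple_isAlgebraic : ∀ j, IsAlgebraic ℚ (algQuadruple j) := by
  intro j
  fin_cases j
  · simpa [algQuadruple] using isAlgebraic_one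
  · simpa [algQuadruple] using isAlgebraic_I
  · simpa [algQuadruple] using isAlgebraic_sqrt_two
  · simpa [algQuadruple] using (mem_algebraicClosure_iff.mp (mul_mem (mem_algebraicClosure_iff.mpr isAlgebraic_I)
      (mem_algebraicClosure_iff.mpr isAlgebraic_sqrt_two)) : IsAlgebraic ℚ (I * ((Real.sqrt 2 : ℝ) : ℂ)))

/-- **`Q₁ = (π | 1, i, √2)`** — a quadruple: `e^{Q₁} = (e^π, e, eⁱ, e^{√2})`. -/
def Q₁ : Fin 4 → ℂ := Fin.cons (Real.pi : ℂ) algTriple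

/-- **`Q₂ = (π | 1, i, √2, i√2)`** — a quintuple. -/
def Q₂ : Fin 5 → ℂ := Fin.cons (Real.pi : ℂ) algQuadruple

/-- **`Q₁` is a certified member of stmt-31410's class AT LENGTH 4** — the first open length of the type-free
component of the residual (round 10: every special class so far was inert from length 4 on). -/
theorem Q₁_mem_plainClass :
    LinearIndependent ℚ Q₁ ∧
      (∀ β : ℂ, IsAlgebraic ℚ β → (∀ i, β * Q₁ i ∈ Submodule.span ℚ (Set.range Q₁)) →
        β ∈ Set.range (algebraMap ℚ ℂ)) ∧ SubMinimalDefect 4 Q₁ :=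
  cons_mem_plainClass transcendental_pi_complex algTriple_linearIndependent algTriple_isAlgebraic

/-- **stmt-31410's conclusion at `Q₁`: `trdeg ℚ(π, i, √2, e^π, e, eⁱ, e^{√2}) ≥ 3`, PROVED** (hypothesis-free). `S`
itself is OPEN at `Q₁` (it asks `trdeg = 4`, i.e. `π` or `e^π` transcendental over `ℚ(e, eⁱ, e^{√2})`). -/
theorem defectOne_at_Q₁ :
    ((4 : ℕ) : Cardinal) ≤ Algebra.trdeg ℚ ↥(adjoin ℚ (Set.range Q₁ ∪ Set.range (cexp ∘ Q₁))) + 1 :=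
  defectOne_at_cons algTriple_linearIndependent algTriple_isAlgebraic

/-- `Q₂` is a certified member of stmt-31410's class at length 5, and 31410's conclusion there is PROVED. -/
theorem Q₂_mem_plainClass :
    LinearIndependent ℚ Q₂ ∧
      (∀ β : ℂ, IsAlgebraic ℚ β → (∀ i, β * Q₂ i ∈ Submodule.span ℚ (Set.range Q₂)) →
        β ∈ Set.range (algebraMap ℚ ℂ)) ∧ SubMinimalDefect 5 Q₂ :=
  cons_mem_plainClass transcendental_pi_complex algQuadruple_linearIndependent algQuadruple_isAlgebraic
/-- S⁻'s conclusion at the literal member `Q₂`: `5 ≤ trdeg ℚ(Q₂, e^{Q₂}) + 1`. -/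
theorem defectOne_at_Q₂ :
    ((5 : ℕ) : Cardinal) ≤ Algebra.trdeg ℚ ↥(adjoin ℚ (Set.range Q₂ ∪ Set.range (cexp ∘ Q₂))) + 1 :=
  defectOne_at_cons algQuadruple_linearIndependent algQuadruple_isAlgebraic

/-- Both literal members are LW-SATURATED (levels 3 at length 4, 4 at length 5): outside the new residual's class. -/
theorem Q₁_lwLevel : LWLevel 3 Q₁ := cons_lwLevel algTriple_linearIndependent algTriple_isAlgebraic
/-- `Q₂` has Lindemann–Weierstrass level `4`. -/
theorem Q₂_lwLevel : LWLevel 4 Q₂ := cons_lwLevel algQuadruple_linearIndependent algQuadruple_isAlgebraic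

/-! ## §6 The `n = 3` dark layer split by level: the E-BASED cell and its ANCHORING (E-R11 (a)) -/
/-- LEVEL-ONE layer 3: `S⁻` at ℚ-free triples of LW-level `≥ 1` (one nonzero algebraic `b` with `e^b ∈ F_z^{alg}`). -/
def LevelOneDefectOneThree : Prop :=
  ∀ (z : Fin 3 → ℂ), LinearIndependent ℚ z → LWLevel 1 z →
    (3 : Cardinal) ≤ Algebra.trdeg ℚ ↥(IntermediateField.adjoin ℚ (Set.range z ∪ Set.range (Complex.exp ∘ z))) + 1

/-- LEVEL-ZERO layer 3 (the deep residual at `n = 3`): `S⁻` at ℚ-free triples of LW-level `0`. -/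
def LevelZeroDefectOneThree : Prop :=
  ∀ (z : Fin 3 → ℂ), LinearIndependent ℚ z → ¬ LWLevel 1 z →
    (3 : Cardinal) ≤ Algebra.trdeg ℚ ↥(IntermediateField.adjoin ℚ (Set.range z ∪ Set.range (Complex.exp ∘ z))) + 1

/-- **THE E-BASED CELL, ANCHORED FORM** (the algebraic logarithm IN THE SPAN): for every nonzero algebraic `b` and
every ℚ-free triple `z` with `b ∈ span_ℚ z`, NOT all of `z₁, z₂, z₃, e^{z₁}, e^{z₂}, e^{z₃}` are algebraic over
`ℚ(e^b)`.  Equivalently: the field `ℚ(e^b)^{alg}` (`b ∈ ℚ̄ˣ`) carries at most TWO ℚ-independent `v` with `v, e^v`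
both in it.  First open instances: `(1, e, e²)` (not both `e^e, e^{e²} ∈ ℚ(e)^{alg}` — stmt-31410's why-text witness),
`(1, e, e^e)`. -/
def AnchoredEBasedDefectOneThree : Prop :=
  ∀ (b : ℂ), IsAlgebraic ℚ b → b ≠ 0 → ∀ (z : Fin 3 → ℂ), LinearIndependent ℚ z →
    b ∈ Submodule.span ℚ (Set.range z) →
      ¬ ∀ i, IsAlgebraic ↥(IntermediateField.adjoin ℚ ({Complex.exp b} : Set ℂ)) (z i) ∧
        IsAlgebraic ↥(IntermediateField.adjoin ℚ ({Complex.exp b} : Set ℂ)) (Complex.exp (z i))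

/-- The same cell WITHOUT the anchoring `b ∈ span_ℚ z`. -/
def EBasedDefectOneThree : Prop :=
  ∀ (b : ℂ), IsAlgebraic ℚ b → b ≠ 0 → ∀ (z : Fin 3 → ℂ), LinearIndependent ℚ z →
    ¬ ∀ i, IsAlgebraic ↥(IntermediateField.adjoin ℚ ({Complex.exp b} : Set ℂ)) (z i) ∧
      IsAlgebraic ↥(IntermediateField.adjoin ℚ ({Complex.exp b} : Set ℂ)) (Complex.exp (z i))

/-- Layer 3 splits by level (sub-minimality is automatic at length 3). -/
theorem firstFailureLayer_three_iff_levels :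
    FirstFailureLayer 3 ↔ LevelOneDefectOneThree ∧ LevelZeroDefectOneThree := by
  refine ⟨fun h => ⟨fun z hz _ => ?_, fun z hz _ => ?_⟩, fun ⟨h1, h0⟩ z hz _ => ?_⟩
  · exact_mod_cast h z hz (subMinimal_three z)
  · exact_mod_cast h z hz (subMinimal_three z)
  · by_cases hL : LWLevel 1 z
    · exact_mod_cast h1 z hz hL
    · exact_mod_cast h0 z hz hL

/-- `ℚ(e^b)` has transcendence degree `≤ 1`. -/
theorem trdeg_expField_le_one (b : ℂ) :
    Algebra.trdeg ℚ ↥(adjoin ℚ ({cexp b} : Set ℂ)) ≤ ((1 : ℕ) : Cardinal) :=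
  trdeg_adjoin_le_nat _ (by simp)

/-- **ANCHORING LEMMA**: the anchored and the free form of the E-based cell are EQUIVALENT (if `b ∉ span_ℚ z`,
pass to the ℚ-free triple `(b, z₁, z₂)`, which is anchored and still exponentially algebraic over `ℚ(e^b)`). -/
theorem eBased_iff_anchored : EBasedDefectOneThree ↔ AnchoredEBasedDefectOneThree := by
  refine ⟨fun h b hb hb0 z hz _ => h b hb hb0 z hz, fun h b hb hb0 z hz hall => ?_⟩
  by_cases hmem : b ∈ Submodule.span ℚ (Set.range z)
  · exact h b hb hb0 z hz hmem hall
  · -- the triple `(b, z 0, z 1)`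
    have hz01 : LinearIndependent ℚ ![z 0, z 1] := by
      have := hz.comp ![(0 : Fin 3), 1] (injective_pair (by decide))
      convert this using 1
      ext i; fin_cases i <;> rfl
    have hb' : b ∉ Submodule.span ℚ (Set.range ![z 0, z 1]) := fun hb' =>
      hmem (span_range_le (fun j => by fin_cases j <;> exact Submodule.subset_span ⟨_, rfl⟩) hb')
    have hli : LinearIndependent ℚ (Fin.cons b ![z 0, z 1] : Fin 3 → ℂ) :=
      linearIndependent_finCons.mpr ⟨hz01, hb'⟩
    refine h b hb hb0 (Fin.cons b ![z 0, z 1]) hli (Submodule.subset_span ⟨0, rfl⟩) ?_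
    intro i
    refine Fin.cases ?_ (fun j => ?_) i
    · refine ⟨(hb.tower_top _ : IsAlgebraic ↥(adjoin ℚ ({cexp b} : Set ℂ)) b), ?_⟩
      simpa using isAlgebraic_of_mem_adjoin (L := adjoin ℚ ({cexp b} : Set ℂ)) (mem_adjoin_simple_self ℚ (cexp b))
    · fin_cases j
      · simpa using hall 0
      · simpa using hall 1

/-- (→) **LEVEL-ONE LAYER ⟹ E-BASED CELL**: a ℚ-free triple exponentially algebraic over `ℚ(e^b)` has
`trdeg F_z ≤ 1`, and `e^b ∈ F_z^{alg}` (exchange against a transcendental generator of `F_z`), so it has level `≥ 1`. -/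
theorem eBased_of_levelOne (h : LevelOneDefectOneThree) : EBasedDefectOneThree := by
  intro b hb hb0 z hz hall
  set K : IntermediateField ℚ ℂ := adjoin ℚ ({cexp b} : Set ℂ) with hK
  -- trdeg F_z ≤ 1
  have hFle : Algebra.trdeg ℚ ↥(adjoin ℚ (Set.range z ∪ Set.range (cexp ∘ z))) ≤ ((1 : ℕ) : Cardinal) := by
    refine (trdeg_adjoin_le_of_isAlgebraic (K := K) ?_).trans (trdeg_expField_le_one b)
    rintro w (⟨i, rfl⟩ | ⟨i, rfl⟩)
    · exact (hall i).1
    · exact (hall i).2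
  -- e^b is transcendental (Hermite–Lindemann)
  have heb : ¬ IsAlgebraic ℚ (cexp b) := transcendental_exp_holds hb hb0
  -- a transcendental generator `t` of `F_z`: `z 0` or `e^{z 0}`
  have hz0 : z 0 ≠ 0 := hz.ne_zero 0
  obtain ⟨t, htF, htK, htT⟩ : ∃ t : ℂ, t ∈ adjoin ℚ (Set.range z ∪ Set.range (cexp ∘ z)) ∧
      IsAlgebraic ↥K t ∧ ¬ IsAlgebraic ℚ t := by
    by_cases hz0a : IsAlgebraic ℚ (z 0)
    · exact ⟨cexp (z 0), subset_adjoin ℚ _ (Or.inr ⟨0, rfl⟩), (hall 0).2, transcendental_exp_holds hz0a hz0⟩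
    · exact ⟨z 0, subset_adjoin ℚ _ (Or.inl ⟨0, rfl⟩), (hall 0).1, hz0a⟩
  -- e^b is algebraic over ℚ(t): sandwich in ℚ(t, e^b), which has trdeg ≤ 1
  have hTle : Algebra.trdeg ℚ ↥(adjoin ℚ ({t, cexp b} : Set ℂ)) ≤ ((1 : ℕ) : Cardinal) := by
    refine (trdeg_adjoin_le_of_isAlgebraic (K := K) ?_).trans (trdeg_expField_le_one b)
    rintro w (rfl | rfl)
    · exact htK
    · exact isAlgebraic_of_mem_adjoin (mem_adjoin_simple_self ℚ (cexp b))
  have hebt : IsAlgebraic ↥(adjoin ℚ ({t} : Set ℂ)) (cexp b) :=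
    isAlgebraic_of_trdeg_sandwich (subset_adjoin ℚ _ (by simp)) (by simp) hTle
      (Summit.Schanuel.Schanuel.Theorems.RootDecomp1EAnchor.one_le_trdeg_adjoin_singleton htT)
  have hebF : IsAlgebraic ↥(adjoin ℚ (Set.range z ∪ Set.range (cexp ∘ z))) (cexp b) :=
    isAlgebraic_of_le (adjoin_le_iff.mpr (Set.singleton_subset_iff.mpr htF)) hebt
  -- so z has level ≥ 1, and the level-one layer gives trdeg ≥ 2: contradiction
  have hL : LWLevel 1 z := ⟨![b], by simpa [linearIndependent_unique_iff] using hb0, fun j => by fin_cases j; simpa using hb,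
    fun j => by fin_cases j; simpa using hebF⟩
  have h3 := h z hz hL
  obtain ⟨s, hs, _⟩ := trdeg_eq_nat z
  rw [hs] at h3 hFle
  have h3' : 3 ≤ s + 1 := by exact_mod_cast h3
  have h1' : s ≤ 1 := by exact_mod_cast hFle
  omega

/-- (←) **E-BASED CELL ⟹ LEVEL-ONE LAYER**: at a level-`≥ 1` triple with `trdeg F_z ≤ 1`, `e^b ∈ F_z^{alg}` is
transcendental, so EVERYTHING in `F_z` is algebraic over `ℚ(e^b)` (sandwich) — the E-based cell forbids it. -/
theorem levelOne_of_eBased (h : EBasedDefectOneThree) : LevelOneDefectOneThree := by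
  intro z hz hL
  obtain ⟨b, hbli, hbalg, hbF⟩ := hL
  have hb0 : b 0 ≠ 0 := hbli.ne_zero 0
  obtain ⟨s, hs, _⟩ := trdeg_eq_nat z
  rw [hs]
  by_contra hlt
  have hs1 : s ≤ 1 := by
    have : ¬ (3 : ℕ) ≤ s + 1 := fun h' => hlt (by exact_mod_cast h')
    omega
  set K : IntermediateField ℚ ℂ := adjoin ℚ ({cexp (b 0)} : Set ℂ) with hK
  have heb : ¬ IsAlgebraic ℚ (cexp (b 0)) := transcendental_exp_holds (hbalg 0) hb0
  -- T = gens(F_z) ∪ {e^{b 0}} has trdeg ≤ trdeg F_z ≤ 1; S = {e^{b 0}} has trdeg ≥ 1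
  set T : Set ℂ := (Set.range z ∪ Set.range (cexp ∘ z)) ∪ {cexp (b 0)} with hT
  have hTle : Algebra.trdeg ℚ ↥(adjoin ℚ T) ≤ ((1 : ℕ) : Cardinal) := by
    refine (trdeg_adjoin_le_of_isAlgebraic (K := adjoin ℚ (Set.range z ∪ Set.range (cexp ∘ z))) ?_).trans
      (by rw [hs]; exact_mod_cast hs1)
    rintro w (hw | rfl)
    · exact isAlgebraic_of_mem_adjoin (subset_adjoin ℚ _ hw)
    · exact hbF 0
  have halgK : ∀ w ∈ adjoin ℚ T, IsAlgebraic ↥K w := fun w hw =>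
    isAlgebraic_of_trdeg_sandwich hw (by simp [hT]) hTle
      (Summit.Schanuel.Schanuel.Theorems.RootDecomp1EAnchor.one_le_trdeg_adjoin_singleton heb)
  have hFT : adjoin ℚ (Set.range z ∪ Set.range (cexp ∘ z)) ≤ adjoin ℚ T := adjoin.mono ℚ _ _ Set.subset_union_left
  exact h (b 0) (hbalg 0) hb0 z hz fun i =>
    ⟨halgK _ (hFT (subset_adjoin ℚ _ (Or.inl ⟨i, rfl⟩))), halgK _ (hFT (subset_adjoin ℚ _ (Or.inr ⟨i, rfl⟩)))⟩

/-- **THE LEVEL-ONE LAYER IS EXACTLY THE (ANCHORED) E-BASED CELL.** -/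
theorem levelOne_iff_anchoredEBased : LevelOneDefectOneThree ↔ AnchoredEBasedDefectOneThree :=
  ⟨fun h => eBased_iff_anchored.mp (eBased_of_levelOne h), fun h => levelOne_of_eBased (eBased_iff_anchored.mpr h)⟩

/-- COORDINATE FORM (the critic's shape `(b | w₁, w₂)`): for nonzero algebraic `b` and `(b, w₁, w₂)` ℚ-free, not all of
`w₁, w₂, e^{w₁}, e^{w₂}` are algebraic over `ℚ(e^b)`. -/
theorem coordinate_form_of_anchored (h : AnchoredEBasedDefectOneThree) (b w₁ w₂ : ℂ) (hb : IsAlgebraic ℚ b)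
    (hb0 : b ≠ 0) (hli : LinearIndependent ℚ ![b, w₁, w₂]) :
    ¬ (IsAlgebraic ↥(adjoin ℚ ({cexp b} : Set ℂ)) w₁ ∧ IsAlgebraic ↥(adjoin ℚ ({cexp b} : Set ℂ)) w₂ ∧
      IsAlgebraic ↥(adjoin ℚ ({cexp b} : Set ℂ)) (cexp w₁) ∧ IsAlgebraic ↥(adjoin ℚ ({cexp b} : Set ℂ)) (cexp w₂)) := by
  rintro ⟨h1, h2, h3, h4⟩
  refine h b hb hb0 ![b, w₁, w₂] hli (Submodule.subset_span ⟨0, rfl⟩) fun i => ?_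
  fin_cases i
  · refine ⟨by simpa using (hb.tower_top _ : IsAlgebraic ↥(adjoin ℚ ({cexp b} : Set ℂ)) b), ?_⟩
    simpa using isAlgebraic_of_mem_adjoin (L := adjoin ℚ ({cexp b} : Set ℂ)) (mem_adjoin_simple_self ℚ (cexp b))
  · exact ⟨by simpa using h1, by simpa using h3⟩
  · exact ⟨by simpa using h2, by simpa using h4⟩

/-- DEEP-DARK layer 3: `S⁻` at ℚ-free triples that are ENGINE-DARK (round 10) AND of LW-level `0` — the finest
residual at `n = 3` after rounds 9–11. -/
def DeepDarkDefectOneThree : Prop :=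
  ∀ (z : Fin 3 → ℂ), LinearIndependent ℚ z → ¬ EngineRich z → ¬ LWLevel 1 z →
    (3 : Cardinal) ≤ Algebra.trdeg ℚ ↥(IntermediateField.adjoin ℚ (Set.range z ∪ Set.range (Complex.exp ∘ z))) + 1

/-- **LAYER 3 = (anchored E-based cell) ∧ (deep-dark triples)**, modulo the tree-proved engine facts
(`smallTrdeg_thm_2_9_two_two`, `smallTrdeg_thm_2_9_pos`, `nesterenko`, `nesterenko'`; hypothesis form as in round 10). -/
theorem firstFailureLayer_three_iff_anchored_deep
    (hBW : Literature.Barriers.Schanuel.smallTrdeg_thm_2_9_two_two)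
    (h29 : Literature.Barriers.Schanuel.smallTrdeg_thm_2_9_pos) (hN : nesterenko) (hN' : nesterenko') :
    FirstFailureLayer 3 ↔ AnchoredEBasedDefectOneThree ∧ DeepDarkDefectOneThree := by
  rw [firstFailureLayer_three_iff_levels, levelOne_iff_anchoredEBased]
  refine ⟨fun ⟨hA, h0⟩ => ⟨hA, fun z hz _ hL => h0 z hz hL⟩, fun ⟨hA, hD⟩ => ⟨hA, fun z hz hL => ?_⟩⟩
  by_cases hR : EngineRich z
  · have h2 := Summit.Schanuel.Schanuel.Theorems.RootDecomp1EEngineType.two_le_trdeg_of_engineRich hBW h29 hN hN' z hR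
    calc (3 : Cardinal) = 2 + 1 := by norm_num
      _ ≤ _ := add_le_add h2 le_rfl
  · exact hD z hz hR hL

/-! ### §6b A CERTIFIED INSTANCE of the anchored E-based cell: the tower `(1, e, e²)` (31410's why-text witness); its
hypotheses hold by THEOREM, its conclusion there = the open «not both `e^e`, `e^{e²}` algebraic over `ℚ(e)`». -/

/-- The deep tower `(1, e, e²)`. -/
def eTower : Fin 3 → ℂ := ![1, cexp 1, cexp 1 ^ 2]

/-- `(1, e, e²)` is ℚ-linearly independent (a rational relation would be a nonzero polynomial of degree `≤ 2` at `e`). -/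
theorem eTower_linearIndependent : LinearIndependent ℚ eTower := by
  rw [Fintype.linearIndependent_iff]
  intro g hg
  have hsum : (g 0 : ℂ) + g 1 * cexp 1 + g 2 * cexp 1 ^ 2 = 0 := by
    simpa [eTower, Fin.sum_univ_three, Rat.smul_def] using hg
  set p : Polynomial ℚ := Polynomial.C (g 0) + Polynomial.C (g 1) * Polynomial.X +
    Polynomial.C (g 2) * Polynomial.X ^ 2 with hp
  have heval : Polynomial.aeval (cexp 1) p = 0 := by
    simp only [hp, map_add, map_mul, map_pow, Polynomial.aeval_C, Polynomial.aeval_X, eq_ratCast]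
    simpa [Rat.cast_def] using hsum
  have hp0 : p = 0 := by
    by_contra hne
    exact transcendental_rat_cexp_one ⟨p, hne, heval⟩
  have hc : ∀ k : ℕ, p.coeff k = 0 := fun k => by rw [hp0, Polynomial.coeff_zero]
  have h0 := hc 0; have h1 := hc 1; have h2 := hc 2
  simp only [hp, Polynomial.coeff_add, Polynomial.coeff_C_mul, Polynomial.coeff_X_pow, Polynomial.coeff_C,
    Polynomial.coeff_X] at h0 h1 h2
  norm_num at h0 h1 h2
  intro i
  fin_cases i <;> assumption

/-- `b = 1` anchors the tower: the hypotheses of the anchored E-based cell hold at `(1; (1, e, e²))`. -/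
theorem eTower_hypotheses :
    IsAlgebraic ℚ (1 : ℂ) ∧ (1 : ℂ) ≠ 0 ∧ LinearIndependent ℚ eTower ∧ (1 : ℂ) ∈ Submodule.span ℚ (Set.range eTower) :=
  ⟨isAlgebraic_one, one_ne_zero, eTower_linearIndependent, Submodule.subset_span ⟨0, rfl⟩⟩

/-- **THE CELL AT THE TOWER**: at its certified instance `(1; (1, e, e²))` the cell says exactly that `e^e`, `e^{e²}`
are NOT BOTH algebraic over `ℚ(e)` — open (its negation is 31410's why-text scenario «trdeg ℚ(e, e^e, e^{e²}) = 1»). -/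
theorem anchored_at_eTower (h : AnchoredEBasedDefectOneThree) :
    ¬ (IsAlgebraic ↥(adjoin ℚ ({cexp 1} : Set ℂ)) (cexp (cexp 1)) ∧
        IsAlgebraic ↥(adjoin ℚ ({cexp 1} : Set ℂ)) (cexp (cexp 1 ^ 2))) := by
  rintro ⟨hee, hee2⟩
  refine h 1 isAlgebraic_one one_ne_zero eTower eTower_linearIndependent (Submodule.subset_span ⟨0, rfl⟩) fun i => ?_
  have heK : cexp 1 ∈ adjoin ℚ ({cexp 1} : Set ℂ) := mem_adjoin_simple_self ℚ (cexp 1)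
  fin_cases i
  · refine ⟨by simpa [eTower] using (isAlgebraic_one : IsAlgebraic ↥(adjoin ℚ ({cexp 1} : Set ℂ)) (1:ℂ)), ?_⟩
    simpa [eTower] using isAlgebraic_of_mem_adjoin heK
  · refine ⟨by simpa [eTower] using isAlgebraic_of_mem_adjoin heK, ?_⟩
    simpa [eTower] using hee
  · refine ⟨?_, by simpa [eTower] using hee2⟩
    simpa [eTower] using isAlgebraic_of_mem_adjoin (L := adjoin ℚ ({cexp 1} : Set ℂ)) (pow_mem heK 2)

end Summit.Schanuel.Schanuel.Theorems.RootDecomp1ELevels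

end
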